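import Summits.HodgeConjecture.HodgeConjecture.Theorems.A3Liu413LevelFormOfSystem
import Summits.HodgeConjecture.HodgeConjecture.Theorems.A3Liu413TowerKaehlerClassSystem
import Literature.AlgebraicGeometry.ShimuraVarieties.UnitaryBallFubiniStudyWeightLawProofs
import HarnessLib

/-!
# (b) UNCONDITIONAL: the tower `H = colim_K H¹(X_K(ℂ); ℂ)` of the Picard modular surfaces of one hermitian space is unitarizable

Fan A, binder `h413` ([Liu 2021, Prop. 4.13]), junction «Matsushima at the pin», stub (b) `stub_unitarizableAtPin` of line `a3-liu413`
(crux stmt-HodgeConjecture-24833).  Row B3-25 (`BallQuotientKaehlerClassSystem`) and its replacement B3-25′ (`BallFS.fsFormClass_weight_comm`) are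
both OFF the line now: the weight law is a THEOREM (`BallFS.fsFormClass_weight_comm_holds`, B-p11 p608531, weighted potential descent), the tower
Kähler class system is built from it (`HodgeCM.Model.LevelTranslate.exists_towerKaehlerClassSystem`, A-p09 p608481), and the `ω`-normalised
Hodge–Riemann level-form assembly consumes any such system (`HodgeCM.Model.TowerLevel.isUnitarizable_ofModule'_tower_ofSystem`, A-p17 p607970 after
A-p10 p605005).  This file composes the three: `isUnitarizable_ofModule'_tower_of_weightLaw` is p605005's `isUnitarizable_ofModule'_tower` WITHOUT the
hypothesis `hΩ`.

KERNEL ONLY (one theorem; no definition, no named fact, no hypothesis beyond the standard carrier binders `hHD hI hU h₃ hA` of the Model).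
HC_CM is proved only modulo the 7 printed citations until rung 0 closes; of the residual of `h413`, row B3-25 is hereby retired (−1), leaving the fan-B
rows III-2 (a)(c) and III-J3a on the line.
-/

noncomputable section

open Literature.AlgebraicGeometry.ShimuraVarieties
open Literature.AlgebraicGeometry.HodgeTheory
open Literature.NumberTheory.Automorphic
open Literature.NumberTheory.Automorphic.PicardCM
open Literature.NumberTheory.Transcendental (Arapura2012_Cor_15_4_6)

namespace HodgeCM

open HodgeCM.Model.LevelTranslate HodgeCM.Model.TowerCarrier

namespace Model.TowerLevel

/-- **(b) of `h413`, unconditional**: the smooth admissible representation of `U(V)(𝔸_{L₀,f})` on the tower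
`H = colim_K H¹(X_K(ℂ); ℂ)` of the Picard modular surfaces of the anisotropic hermitian space `V` (`[L:ℚ] ≠ 2`) is UNITARIZABLE —
it carries an invariant positive-definite Hermitian form, the glued `ω`-normalised Hodge–Riemann level forms for the tower Kähler class
system `ω_Δ ∈ ℚ_{>0}·c₁(K_{X_Δ})` obtained from the weight law of the Fubini–Study classes.
[cite: Liu2021, Prop. 4.13 proof l. 2121–2131] [cite: VoisinHodgeI2002, §6.3.2 Thm. 6.32] [cite: GriffithsHarrisPrinciples1978, Ch. 1 §2] -/
theorem isUnitarizable_ofModule'_tower_of_weightLaw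
    (hHD : exists_isReal_hodgeModel) (hI : hodgePQ_independent_of_hodgeModel) (hU : BallQuotientUniformisedDatum)
    (h₃ : CMAbelianVarietyRealised) (hA : Arapura2012_Cor_15_4_6) {L : CMField} {ι₁ : L →+* ℂ} (V : HermSpace3 L ι₁)
    (hL : Module.finrank ℚ L ≠ 2) (h : IsAnisotropic L V.Hm) :
    Representation.IsUnitarizable (G := ↥V.adelicFin) (V := Tower hHD hI hU h₃ hA V)
      (Representation.ofModule' (k := ℂ) (G := ↥V.adelicFin) (Tower hHD hI hU h₃ hA V)) :=
  (exists_towerKaehlerClassSystem hHD hU h₃ hA V BallFS.fsFormClass_weight_comm_holds h).elim fun ω hω ↦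
    isUnitarizable_ofModule'_tower_ofSystem hHD hI hU h₃ hA V hL ω hω.1 hω.2.1

end Model.TowerLevel

end HodgeCM

end
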